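import Literature.Geometry.Lorentzian.KerrSchildEnergyEstimate
import HarnessLib

/-!
# The integrated divergence identity on a slab `[t₀, t₁] × B_ρ` for `C¹` currents on `ℝ⁴` with
# spatially compact support

(family `gr`; infrastructure for the physical-space multiplier estimates behind statement
**gr.S24** — Dafermos–Rodnianski–Shlapentokh-Rothman, arXiv:1402.7034, §2.3.2 — in the
coefficient-field framework of `KerrSchild.waveOperator`; namespace
`Literature.Geometry.Lorentzian.E4`)

Dafermos–Rodnianski–Shlapentokh-Rothman (arXiv:1402.7034 = Ann. of Math. 183 (2016)), §2.3.2,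
use the divergence identity
`∫_{S⁺} J_μ n^μ + ∫_𝓑 ∇^μ J_μ = ∫_{S⁻} J_μ n^μ` between two homologous spacelike hypersurfaces for
the multiplier currents `J = J^V[Ψ]`, "typically … where `Ψ` is compactly supported", so that no
lateral boundary terms arise. In a chart with `det g = −1` (the Kerr–Schild chart of Kerr) the
divergence is the coordinate one, `∇_μ J^μ = ∑_μ ∂_μ J^μ`, the volume form is `dt dy`, and for the
slices `S^± = {t = t^±}` the flux density is the time component `J⁰`.

This file proves that identity in this coordinate form, for an **arbitrary** `C¹` current
`J = (J^μ) : ℝ⁴ → ℝ⁴` whose spatial components vanish outside the cylinder `[t₀, t₁] × B_ρ`: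

* `E4.ballIntegral_sub_eq_integral_divergence` —
  `∫_{B_ρ} J⁰(t₁, y) dy − ∫_{B_ρ} J⁰(t₀, y) dy = ∫_{t₀}^{t₁} ∫_{B_ρ} (∑_μ ∂_μ J^μ)(t, y) dy dt`
  (fundamental theorem of calculus in `t`, Fubini on the compact cylinder, and
  `∫_{E3} ∂_{y_i}[J^{i}(t, ·)] dy = 0` for the compactly supported `C¹` slices — the pattern of
  `KerrSchild.Background.ballEnergy_sub_eq` of `KerrSchildEnergyEstimate.lean`, which is the case
  `J = T^{μ0}[w]` of a background, freed from the wave equation);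
* `E4.integral_sub_eq_integral_divergence` — the same over all of `E3` when all four components
  vanish outside the cylinder.

Combined with a pointwise divergence identity (`KerrSchild.sum_fderiv_normalCurrent`,
`Kerr.sum_fderiv_tCurrent`, or the general `∑_μ ∂_μ (J^X)^μ = (□_G w) X(w) + K^X`) this is the
energy identity `E_X(t₁) − E_X(t₀) = ∫∫ ((□_G w) X(w) + K^X)` on slabs for every vector-field
multiplier `X` and every `C²` function `w` of spatially compact support (DRSR §2.3.2,
(ingeneralform), with `S^± = {t = t^±}`).

## References

* M. Dafermos, I. Rodnianski, Y. Shlapentokh-Rothman, arXiv:1402.7034 = Ann. of Math. 183 (2016),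
  §2.3.2 (the divergence identity (ingeneralform) for compactly supported `Ψ`)
  (key `DafermosRodnianskiShlapentokhrothman2014`).
* J. Sbierski, Anal. PDE 8 (2015) 1379–1420, §2, proof of Thm. 2.1 (Stokes' theorem for
  `J ⌟ vol` on slabs) (key `Sbierski2015`).
* S. Alinhac, *Hyperbolic partial differential equations*, Springer 2009, Ch. 7.
-/

noncomputable section

open Set Filter
open scoped ContDiff Topology

namespace Literature.Geometry.Lorentzian

open _root_.MeasureTheory Metric

namespace E4

/-- Chain rule along a slice: `∂_{y_i} [J(t, y)] = (∂_{i+1} J)(t, y)` (a copy of the private lemma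
of `KerrSchildEnergyEstimate.lean`). [folklore] -/
private theorem fderiv_comp_ofTimeSpace_single' {J : E4 → ℝ} {t : ℝ} {y : E3}
    (hJ : DifferentiableAt ℝ J (ofTimeSpace t y)) (i : Fin 3) :
    fderiv ℝ (fun y ↦ J (ofTimeSpace t y)) y (EuclideanSpace.single i 1) =
      fderiv ℝ J (ofTimeSpace t y) (basisVector i.succ) := by
  have h : HasFDerivAt (fun y ↦ J (ofTimeSpace t y)) ((fderiv ℝ J (ofTimeSpace t y)).comp spaceEmbed)
      y := hJ.hasFDerivAt.comp y (hasFDerivAt_ofTimeSpace t y)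
  have hs : spaceEmbed (EuclideanSpace.single i 1) = basisVector i.succ := by
    ext j
    refine Fin.cases ?_ (fun k ↦ ?_) j
    · simp [basisVector, Fin.succ_ne_zero]
    · simp [basisVector, Fin.succ_inj]
  rw [h.fderiv, ContinuousLinearMap.comp_apply, hs]

/-- **The integrated divergence identity on a slab, in a ball.** Let `J = (J^μ)_{μ<4}` be a family
of `C¹` functions on `ℝ⁴` (a `C¹` vector field in the Kerr–Schild chart) whose *spatial*
components vanish at the points `(t, y)` with `t₀ ≤ t ≤ t₁`, `‖y‖ > ρ`. Then
`∫_{B_ρ} J⁰(t₁, y) dy − ∫_{B_ρ} J⁰(t₀, y) dy = ∫_{(t₀, t₁]} ∫_{B_ρ} ∑_μ (∂_μ J^μ)(t, y) dy dt`.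
Proof: `∂_0 J⁰ = ∑_μ ∂_μ J^μ − ∑_i ∂_i J^i`; integrate over `[t₀, t₁] × B_ρ` (fundamental theorem
of calculus in `t` pointwise in `y`, then Fubini on the compact cylinder); on each slice
`∫_{B_ρ} ∂_i J^i (t, y) dy = ∫_{E3} ∂_{y_i} [J^i(t, ·)] dy = 0` because `J^i(t, ·)` is `C¹` with
support in `B_ρ`. This is the divergence identity (ingeneralform) of DRSR arXiv:1402.7034, §2.3.2,
for the slices `S^± = {t = t^±}` of a chart with `det g = −1` and compactly supported fields
(Sbierski, Anal. PDE 8 (2015), §2, proof of Thm. 2.1, for the energy current).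
[cite: DafermosRodnianskiShlapentokhrothman2014, §2.3.2] -/
theorem ballIntegral_sub_eq_integral_divergence {J : Fin 4 → E4 → ℝ}
    (hJ1 : ∀ μ, ContDiff ℝ 1 (J μ)) {ρ t₀ t₁ : ℝ} (h01 : t₀ ≤ t₁)
    (hJ0 : ∀ i : Fin 3, ∀ t ∈ Set.Icc t₀ t₁, ∀ y : E3, ρ < ‖y‖ →
      J i.succ (E4.ofTimeSpace t y) = 0) :
    (∫ y in closedBall (0 : E3) ρ, J 0 (E4.ofTimeSpace t₁ y)) -
        ∫ y in closedBall (0 : E3) ρ, J 0 (E4.ofTimeSpace t₀ y) =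
      ∫ t in Set.Ioc t₀ t₁, ∫ y in closedBall (0 : E3) ρ,
        ∑ μ, fderiv ℝ (J μ) (E4.ofTimeSpace t y) (E4.basisVector μ) := by
  -- regularity
  have hJd : ∀ μ x, DifferentiableAt ℝ (J μ) x := fun μ x ↦ (hJ1 μ).differentiable one_ne_zero x
  have hdJc : ∀ μ (v : E4), Continuous fun x ↦ fderiv ℝ (J μ) x v :=
    fun μ v ↦ ((hJ1 μ).continuous_fderiv one_ne_zero).clm_apply continuous_const
  -- the divergence, solved for `∂_0 J⁰`
  have hdiv : ∀ x, fderiv ℝ (J 0) x (E4.basisVector 0) =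
      (∑ μ, fderiv ℝ (J μ) x (E4.basisVector μ)) -
        ∑ i : Fin 3, fderiv ℝ (J i.succ) x (E4.basisVector i.succ) := by
    intro x
    rw [Fin.sum_univ_succ]
    ring
  -- ### Step 1: fundamental theorem of calculus in `t`, pointwise in `y`
  have hFTC : ∀ y : E3, J 0 (E4.ofTimeSpace t₁ y) - J 0 (E4.ofTimeSpace t₀ y) =
      ∫ t in t₀..t₁, fderiv ℝ (J 0) (E4.ofTimeSpace t y) (E4.basisVector 0) := by
    intro y
    rw [intervalIntegral.integral_eq_sub_of_hasDerivAt]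
    · intro t _
      exact (hJd 0 _).hasFDerivAt.comp_hasDerivAt t (E4.hasDerivAt_ofTimeSpace_left t y)
    · exact ((hdJc 0 _).comp (E4.continuous_ofTimeSpace_uncurry.comp
        (continuous_id.prodMk continuous_const))).intervalIntegrable _ _
  -- ### Step 2: integrate over the ball and swap the integrals
  have hK : IsCompact (closedBall (0 : E3) ρ ×ˢ Set.Icc t₀ t₁) :=
    (isCompact_closedBall _ _).prod isCompact_Icc
  have hF : Continuous fun p : E3 × ℝ ↦ fderiv ℝ (J 0) (E4.ofTimeSpace p.2 p.1) (E4.basisVector 0) :=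
    (hdJc 0 _).comp (E4.continuous_ofTimeSpace_uncurry.comp (continuous_snd.prodMk continuous_fst))
  have hInt : Integrable (Function.uncurry fun (y : E3) (t : ℝ) ↦
      fderiv ℝ (J 0) (E4.ofTimeSpace t y) (E4.basisVector 0))
      ((volume.restrict (closedBall (0 : E3) ρ)).prod (volume.restrict (Set.Ioc t₀ t₁))) := by
    rw [Measure.prod_restrict, ← Measure.volume_eq_prod]
    exact ((hF.continuousOn.integrableOn_compact hK).mono_set
      (Set.prod_mono le_rfl Set.Ioc_subset_Icc_self))
  have hswap := integral_integral_swap hInt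
  -- ### Step 3: the spatial divergence integrates to zero on each slice
  have hslice : ∀ t ∈ Set.Icc t₀ t₁,
      ∫ y in closedBall (0 : E3) ρ, fderiv ℝ (J 0) (E4.ofTimeSpace t y) (E4.basisVector 0) =
      ∫ y in closedBall (0 : E3) ρ,
        ∑ μ, fderiv ℝ (J μ) (E4.ofTimeSpace t y) (E4.basisVector μ) := by
    intro t ht
    simp only [hdiv]
    have hint1 : IntegrableOn
        (fun y : E3 ↦ ∑ μ, fderiv ℝ (J μ) (E4.ofTimeSpace t y) (E4.basisVector μ))
        (closedBall (0 : E3) ρ) :=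
      ((continuous_finsetSum _ fun μ _ ↦ (hdJc μ _).comp
        (E4.continuous_ofTimeSpace t))).continuousOn.integrableOn_compact (isCompact_closedBall _ _)
    have hint2 : ∀ i : Fin 3, IntegrableOn
        (fun y : E3 ↦ fderiv ℝ (J i.succ) (E4.ofTimeSpace t y) (E4.basisVector i.succ))
        (closedBall (0 : E3) ρ) := fun i ↦
      ((hdJc _ _).comp (E4.continuous_ofTimeSpace t)).continuousOn.integrableOn_compact
        (isCompact_closedBall _ _)
    rw [integral_sub hint1 (integrable_finsetSum _ fun i _ ↦ hint2 i), sub_eq_self,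
      integral_finsetSum _ fun i _ ↦ hint2 i]
    refine Finset.sum_eq_zero fun i _ ↦ ?_
    -- the slice `y ↦ J^{i+1}(t, y)` is `C¹` with support in the closed ball
    have hg1 : ContDiff ℝ 1 fun y : E3 ↦ J i.succ (E4.ofTimeSpace t y) :=
      (hJ1 _).comp (E4.contDiff_ofTimeSpace t)
    have hg0 : ∀ y : E3, ρ < ‖y‖ → J i.succ (E4.ofTimeSpace t y) = 0 := fun y hy ↦ hJ0 i t ht y hy
    have hgc : HasCompactSupport fun y : E3 ↦ J i.succ (E4.ofTimeSpace t y) := by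
      refine HasCompactSupport.intro (isCompact_closedBall (0 : E3) ρ) fun y hy ↦ ?_
      rw [mem_closedBall, dist_zero_right, not_le] at hy
      exact hg0 y hy
    have hchain : ∀ y : E3, fderiv ℝ (J i.succ) (E4.ofTimeSpace t y) (E4.basisVector i.succ) =
        fderiv ℝ (fun y : E3 ↦ J i.succ (E4.ofTimeSpace t y)) y (EuclideanSpace.single i 1) :=
      fun y ↦ (fderiv_comp_ofTimeSpace_single' (hJd _ _) i).symm
    -- `∫_{B_ρ} ∂_{i+1} J^{i+1} = ∫_{E3} ∂_{y_i} [J^{i+1}(t, ·)] = 0`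
    have hzero : ∀ y : E3, y ∉ closedBall (0 : E3) ρ →
        fderiv ℝ (J i.succ) (E4.ofTimeSpace t y) (E4.basisVector i.succ) = 0 := by
      intro y hy
      rw [mem_closedBall, dist_zero_right, not_le] at hy
      rw [hchain]
      have hO : IsOpen {z : E3 | ρ < ‖z‖} := isOpen_lt continuous_const continuous_norm
      have hev : (fun z : E3 ↦ J i.succ (E4.ofTimeSpace t z)) =ᶠ[𝓝 y] fun _ ↦ 0 :=
        Filter.eventually_of_mem (hO.mem_nhds hy) fun z hz ↦ hg0 z hz
      rw [hev.fderiv_eq]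
      simp
    rw [setIntegral_eq_integral_of_forall_compl_eq_zero hzero]
    simp only [hchain]
    exact integral_fderiv_apply_eq_zero_of_hasCompactSupport hg1 hgc _
  -- ### assemble
  have hE : ∀ s : ℝ, IntegrableOn (fun y : E3 ↦ J 0 (E4.ofTimeSpace s y)) (closedBall (0 : E3) ρ) :=
    fun s ↦ ((hJ1 0).continuous.comp (E4.continuous_ofTimeSpace s)).continuousOn.integrableOn_compact
      (isCompact_closedBall _ _)
  calc (∫ y in closedBall (0 : E3) ρ, J 0 (E4.ofTimeSpace t₁ y)) -
        ∫ y in closedBall (0 : E3) ρ, J 0 (E4.ofTimeSpace t₀ y)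
      = ∫ y in closedBall (0 : E3) ρ, (J 0 (E4.ofTimeSpace t₁ y) - J 0 (E4.ofTimeSpace t₀ y)) := by
        rw [← integral_sub (hE t₁) (hE t₀)]
    _ = ∫ y in closedBall (0 : E3) ρ, ∫ t in Set.Ioc t₀ t₁,
          fderiv ℝ (J 0) (E4.ofTimeSpace t y) (E4.basisVector 0) := by
        refine setIntegral_congr_fun measurableSet_closedBall fun y _ ↦ ?_
        rw [hFTC y, intervalIntegral.integral_of_le h01]
    _ = ∫ t in Set.Ioc t₀ t₁, ∫ y in closedBall (0 : E3) ρ,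
          fderiv ℝ (J 0) (E4.ofTimeSpace t y) (E4.basisVector 0) := hswap
    _ = _ := by
        refine setIntegral_congr_fun measurableSet_Ioc fun t ht ↦ ?_
        exact hslice t ⟨ht.1.le, ht.2⟩

/-- **The integrated divergence identity on a slab, over all of space.** If all four components
of the `C¹` current `J` vanish at the points `(t, y)` with `t₀ ≤ t ≤ t₁`, `‖y‖ > ρ`, then
`∫_{E3} J⁰(t₁, y) dy − ∫_{E3} J⁰(t₀, y) dy = ∫_{(t₀, t₁]} ∫_{E3} ∑_μ (∂_μ J^μ)(t, y) dy dt`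
(DRSR arXiv:1402.7034, §2.3.2, (ingeneralform) with `S^± = {t = t^±}` and compactly supported
fields, in a chart with `det g = −1`). [cite: DafermosRodnianskiShlapentokhrothman2014, §2.3.2] -/
theorem integral_sub_eq_integral_divergence {J : Fin 4 → E4 → ℝ}
    (hJ1 : ∀ μ, ContDiff ℝ 1 (J μ)) {ρ t₀ t₁ : ℝ} (h01 : t₀ ≤ t₁)
    (hJ0 : ∀ μ, ∀ t ∈ Set.Icc t₀ t₁, ∀ y : E3, ρ < ‖y‖ → J μ (E4.ofTimeSpace t y) = 0) :
    (∫ y, J 0 (E4.ofTimeSpace t₁ y)) - ∫ y, J 0 (E4.ofTimeSpace t₀ y) =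
      ∫ t in Set.Ioc t₀ t₁, ∫ y, ∑ μ, fderiv ℝ (J μ) (E4.ofTimeSpace t y) (E4.basisVector μ) := by
  have hJd : ∀ μ x, DifferentiableAt ℝ (J μ) x := fun μ x ↦ (hJ1 μ).differentiable one_ne_zero x
  have hball := ballIntegral_sub_eq_integral_divergence hJ1 h01 fun i ↦ hJ0 i.succ
  have hO : IsOpen {z : E3 | ρ < ‖z‖} := isOpen_lt continuous_const continuous_norm
  -- `J⁰(t, ·)` vanishes off the closed ball for `t ∈ [t₀, t₁]`
  have hz0 : ∀ t ∈ Set.Icc t₀ t₁, ∀ y : E3, y ∉ closedBall (0 : E3) ρ →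
      J 0 (E4.ofTimeSpace t y) = 0 := by
    intro t ht y hy
    rw [mem_closedBall, dist_zero_right, not_le] at hy
    exact hJ0 0 t ht y hy
  -- the divergence vanishes off the closed ball for `t ∈ (t₀, t₁]`: the spatial derivatives
  -- through the slice `J^μ(t, ·) = 0` on the open set `{‖z‖ > ρ}`, the time derivative because
  -- `s ↦ J^μ(s, y)` vanishes on `[t₀, t₁]` (zero derivative inside, and at `t₁` by continuity of
  -- `∂_0 J^μ`)
  have hzdiv : ∀ t ∈ Set.Ioc t₀ t₁, ∀ y : E3, y ∉ closedBall (0 : E3) ρ →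
      ∑ μ, fderiv ℝ (J μ) (E4.ofTimeSpace t y) (E4.basisVector μ) = 0 := by
    intro t ht y hy
    rw [mem_closedBall, dist_zero_right, not_le] at hy
    have hlt : t₀ < t₁ := ht.1.trans_le ht.2
    have ht' : t ∈ Set.Icc t₀ t₁ := ⟨ht.1.le, ht.2⟩
    refine Finset.sum_eq_zero fun μ _ ↦ ?_
    have hspace : ∀ i : Fin 3, fderiv ℝ (J μ) (E4.ofTimeSpace t y) (E4.basisVector i.succ) = 0 := by
      intro i
      rw [← fderiv_comp_ofTimeSpace_single' (hJd _ _) i]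
      have hev : (fun z : E3 ↦ J μ (E4.ofTimeSpace t z)) =ᶠ[𝓝 y] fun _ ↦ 0 :=
        Filter.eventually_of_mem (hO.mem_nhds hy) fun z hz ↦ hJ0 μ t ht' z hz
      rw [hev.fderiv_eq]
      simp
    have htime : fderiv ℝ (J μ) (E4.ofTimeSpace t y) (E4.basisVector 0) = 0 := by
      have hder : ∀ s, HasDerivAt (fun s : ℝ ↦ J μ (E4.ofTimeSpace s y))
          (fderiv ℝ (J μ) (E4.ofTimeSpace s y) (E4.basisVector 0)) s := fun s ↦
        (hJd μ _).hasFDerivAt.comp_hasDerivAt s (E4.hasDerivAt_ofTimeSpace_left s y)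
      have hcont : Continuous fun s : ℝ ↦ fderiv ℝ (J μ) (E4.ofTimeSpace s y) (E4.basisVector 0) :=
        (((hJ1 μ).continuous_fderiv one_ne_zero).clm_apply continuous_const).comp
          (E4.continuous_ofTimeSpace_uncurry.comp (continuous_id.prodMk continuous_const))
      have hint : ∀ s ∈ Set.Ioo t₀ t₁,
          fderiv ℝ (J μ) (E4.ofTimeSpace s y) (E4.basisVector 0) = 0 := by
        intro s hs
        have hev : (fun r : ℝ ↦ J μ (E4.ofTimeSpace r y)) =ᶠ[𝓝 s] fun _ ↦ 0 :=
          Filter.eventually_of_mem (isOpen_Ioo.mem_nhds hs) fun r hr ↦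
            hJ0 μ r (Set.Ioo_subset_Icc_self hr) y hy
        have h1 := (hder s).deriv
        rw [hev.deriv_eq] at h1
        simpa using h1.symm
      have hclos : t ∈ closure (Set.Ioo t₀ t₁) := by
        rw [closure_Ioo hlt.ne]
        exact ht'
      exact (isClosed_eq hcont continuous_const).closure_subset_iff.mpr (fun s hs ↦ hint s hs) hclos
    fin_cases μ
    · exact htime
    · exact hspace 0
    · exact hspace 1
    · exact hspace 2
  rw [← setIntegral_eq_integral_of_forall_compl_eq_zero (hz0 t₁ ⟨h01, le_rfl⟩),
    ← setIntegral_eq_integral_of_forall_compl_eq_zero (hz0 t₀ ⟨le_rfl, h01⟩), hball]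
  refine setIntegral_congr_fun measurableSet_Ioc fun t ht ↦ ?_
  exact setIntegral_eq_integral_of_forall_compl_eq_zero (hzdiv t ht)

end E4

end Literature.Geometry.Lorentzian
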